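import Mathlib

/-!
# Roots of unity of order prime to the residue characteristic are not `≡ 1` modulo the
  maximal ideal (Theorem N5.T3, the injection `μ(E) → E¹_w / (E¹_w ∩ U²)`)

Theorem N5.T3 of `route/TIER5.md` §N5.11.6 (global assembly through three auxiliary inert
places `w = aux_i` with residue characteristic `p_w ∤ |μ(E)|`) uses: «`μ(E)` injects into
`G := E¹_w/(E¹_w ∩ U²_{E_w})` (a root of unity of order prime to `p_w` that is `≡ 1 mod P_{E_w}`,
a fortiori `mod P²_{E_w}`, is `1`)». This file checks the parenthesis for an arbitrary local
domain `R` (the ring of integers `O_{E_w}` of the prose):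

* `eq_zero_of_one_add_pow_eq_one`: if `x` lies in the maximal ideal, `(1 + x)^m = 1` and `m` is a
  unit of `R`, then `x = 0` — `(1+x)^m − 1 = x · Σ_{i<m} (1+x)^i` and the sum is `m + x·s`, a
  unit (Mathlib's `geom_sum₂_mul`);
* `eq_one_of_pow_eq_one_of_sub_one_mem`: a root of unity `ζ` with `ζ ≡ 1` modulo the maximal
  ideal and `ζ^m = 1`, `m` a unit, is `1`;
* `isUnit_natCast_of_not_dvd`: when the residue field has prime characteristic `p`
  (`(p : R)` in the maximal ideal), every `m` with `p ∤ m` is a unit of `R` — so the hypothesis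
  «`m` a unit» is exactly the prose's «order prime to `p_w`»
  (`eq_one_of_pow_eq_one_of_sub_one_mem_of_not_dvd`).

The prose's `U²` is handled a fortiori: `ζ ≡ 1 mod P²` implies `ζ ≡ 1 mod P`.
Declaration per README §8(d): «uses an L-value-free non-vanishing device: NO».
-/

namespace Summit.Ventures.HodgeRepro2.T5RootsOfUnityModMaximal

variable {R : Type*} [CommRing R] [IsLocalRing R]

omit [IsLocalRing R] in
/-- `Σ_{i<m} (1 + x)^i = m + x · s` for some `s`: each summand is `1` modulo `x`. -/
theorem exists_geom_sum_eq (x : R) (m : ℕ) :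
    ∃ s : R, (∑ i ∈ Finset.range m, (1 + x) ^ i * (1 : R) ^ (m - 1 - i)) = (m : R) + x * s := by
  induction m with
  | zero => exact ⟨0, by simp⟩
  | succ n ih =>
    obtain ⟨s, hs⟩ := ih
    -- the summands only change through the exponent bookkeeping `n - 1 - i` vs `n - i`
    have e : (∑ i ∈ Finset.range (n + 1), (1 + x) ^ i * (1 : R) ^ (n + 1 - 1 - i)) =
        ∑ i ∈ Finset.range (n + 1), (1 + x) ^ i := by
      refine Finset.sum_congr rfl fun i _ => ?_
      rw [one_pow, mul_one]
    have e' : (∑ i ∈ Finset.range n, (1 + x) ^ i * (1 : R) ^ (n - 1 - i)) =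
        ∑ i ∈ Finset.range n, (1 + x) ^ i := by
      refine Finset.sum_congr rfl fun i _ => ?_
      rw [one_pow, mul_one]
    rw [e'] at hs
    obtain ⟨t, ht⟩ : ∃ t : R, (1 + x) ^ n = 1 + x * t := by
      have hd : x ∣ (1 + x) ^ n - 1 := by
        have := sub_dvd_pow_sub_pow (1 + x) 1 n
        rwa [add_sub_cancel_left, one_pow] at this
      obtain ⟨t, ht⟩ := hd
      exact ⟨t, by rw [← ht]; ring⟩
    refine ⟨s + t, ?_⟩
    rw [e, Finset.sum_range_succ, hs, ht]
    push_cast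
    ring

omit [IsLocalRing R] in
/-- `(1 + x)^m − 1 = x · (m + x s)`. -/
theorem one_add_pow_sub_one_eq (x : R) (m : ℕ) :
    ∃ s : R, (1 + x) ^ m - 1 = x * ((m : R) + x * s) := by
  obtain ⟨s, hs⟩ := exists_geom_sum_eq (R := R) x m
  refine ⟨s, ?_⟩
  have h := geom_sum₂_mul (1 + x) (1 : R) m
  rw [add_sub_cancel_left, one_pow] at h
  rw [← h, hs, mul_comm]

/-- In a local domain, `x` in the maximal ideal with `(1 + x)^m = 1` for a unit `m` is `0`. -/
theorem eq_zero_of_one_add_pow_eq_one [IsDomain R] {x : R}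
    (hx : x ∈ IsLocalRing.maximalIdeal R) {m : ℕ} (hm : IsUnit (m : R))
    (h : (1 + x) ^ m = 1) : x = 0 := by
  obtain ⟨s, hs⟩ := one_add_pow_sub_one_eq x m
  rw [h, sub_self] at hs
  rcases mul_eq_zero.1 hs.symm with hx0 | hms
  · exact hx0
  · exfalso
    have hmem : (m : R) ∈ IsLocalRing.maximalIdeal R := by
      have : (m : R) = -(x * s) := by linear_combination hms
      rw [this]
      exact (Ideal.neg_mem_iff _).2 (Ideal.mul_mem_right _ _ hx)
    exact (IsLocalRing.mem_maximalIdeal _).1 hmem hm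

/-- A root of unity `ζ ≡ 1` modulo the maximal ideal, of order `m` a unit of `R`, is `1`:
the prose's «a root of unity of order prime to `p_w` that is `≡ 1 mod P_{E_w}` is `1`». -/
theorem eq_one_of_pow_eq_one_of_sub_one_mem [IsDomain R] {ζ : R}
    (hζ : ζ - 1 ∈ IsLocalRing.maximalIdeal R) {m : ℕ} (hm : IsUnit (m : R))
    (h : ζ ^ m = 1) : ζ = 1 := by
  have h' : (1 + (ζ - 1)) ^ m = 1 := by rwa [add_sub_cancel]
  have := eq_zero_of_one_add_pow_eq_one hζ hm h'
  exact sub_eq_zero.1 this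

/-- If `(p : R)` lies in the maximal ideal for a prime `p` (residue characteristic `p`), every
natural number `m` not divisible by `p` is a unit of `R`. -/
theorem isUnit_natCast_of_not_dvd {p : ℕ} (hp : p.Prime)
    (hpR : (p : R) ∈ IsLocalRing.maximalIdeal R) {m : ℕ} (hm : ¬ p ∣ m) : IsUnit (m : R) := by
  haveI : Fact p.Prime := ⟨hp⟩
  have hres : (p : IsLocalRing.ResidueField R) = 0 := by
    rw [← map_natCast (IsLocalRing.residue R), IsLocalRing.residue_eq_zero_iff]
    exact hpR
  haveI : CharP (IsLocalRing.ResidueField R) p := (CharP.charP_iff_prime_eq_zero hp).2 hres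
  have hne : (m : IsLocalRing.ResidueField R) ≠ 0 := by
    rw [Ne, CharP.cast_eq_zero_iff (IsLocalRing.ResidueField R) p]
    exact hm
  have hunit : IsUnit (IsLocalRing.residue R (m : R)) := by
    rw [map_natCast]
    exact isUnit_iff_ne_zero.2 hne
  exact isUnit_of_map_unit (IsLocalRing.residue R) _ hunit

/-- THE PROSE SENTENCE: in a local domain of residue characteristic `p`, a root of unity of
order `m` prime to `p` that is `≡ 1` modulo the maximal ideal is `1`. -/
theorem eq_one_of_pow_eq_one_of_sub_one_mem_of_not_dvd [IsDomain R] {p : ℕ} (hp : p.Prime)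
    (hpR : (p : R) ∈ IsLocalRing.maximalIdeal R) {ζ : R}
    (hζ : ζ - 1 ∈ IsLocalRing.maximalIdeal R) {m : ℕ} (hm : ¬ p ∣ m) (h : ζ ^ m = 1) : ζ = 1 :=
  eq_one_of_pow_eq_one_of_sub_one_mem hζ (isUnit_natCast_of_not_dvd hp hpR hm) h

/-- The injectivity form: two roots of unity of order prime to `p` that are congruent modulo
the maximal ideal are equal (so a group of roots of unity of order prime to `p` injects into
`Rˣ / U¹`). -/
theorem eq_of_pow_eq_one_of_sub_mem_of_not_dvd [IsDomain R] {p : ℕ} (hp : p.Prime)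
    (hpR : (p : R) ∈ IsLocalRing.maximalIdeal R) {ζ₁ ζ₂ : R} (hζ₁ : IsUnit ζ₂)
    (hmem : ζ₁ - ζ₂ ∈ IsLocalRing.maximalIdeal R) {m : ℕ} (hm : ¬ p ∣ m)
    (h₁ : ζ₁ ^ m = 1) (h₂ : ζ₂ ^ m = 1) : ζ₁ = ζ₂ := by
  obtain ⟨u, rfl⟩ := hζ₁
  have hq : (ζ₁ * ((u⁻¹ : Rˣ) : R)) ^ m = 1 := by
    rw [mul_pow, h₁, one_mul, ← Units.val_pow_eq_pow_val, ← Units.val_one]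
    congr 1
    rw [inv_pow, inv_eq_one]
    exact Units.ext (by rw [Units.val_pow_eq_pow_val, h₂, Units.val_one])
  have hq1 : ζ₁ * ((u⁻¹ : Rˣ) : R) - 1 ∈ IsLocalRing.maximalIdeal R := by
    have e : ζ₁ * ((u⁻¹ : Rˣ) : R) - 1 = (ζ₁ - u) * ((u⁻¹ : Rˣ) : R) := by
      rw [sub_mul, Units.mul_inv]
    rw [e]
    exact Ideal.mul_mem_right _ _ hmem
  have := eq_one_of_pow_eq_one_of_sub_one_mem_of_not_dvd hp hpR hq1 hm hq
  calc ζ₁ = ζ₁ * ((u⁻¹ : Rˣ) : R) * u := by rw [mul_assoc, Units.inv_mul, mul_one]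
    _ = u := by rw [this, one_mul]

end Summit.Ventures.HodgeRepro2.T5RootsOfUnityModMaximal
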